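import Literature.Geometry.Riemannian.VolumeSphereTheoremJacobiFrameProofs
import Literature.Geometry.Riemannian.JacobiVariation
import Literature.Geometry.Riemannian.ExponentialMapProofs
import HarnessLib

/-!
# The Gram determinant of `d(exp_p)_{tv}` in a frame along `γ_v` (Chavel 2006, §III.4)

Bishop's comparison theorem (`jacobi_det_div_pow_antitoneOn`, §8 of
`VolumeSphereTheoremProofs.lean`; Chavel 2006, Thm. III.4.3) controls the **normal Jacobi tensor**
`A(t) = (g(J_k(t), e_i(t)))_{i,k}` of the geodesic `γ_v(t) = exp_p(tv)` in an orthonormal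
frame `(e_i(t))_i` of `γ̇_v(t)^⊥`, where `J_k(t) = ∂_s|₀ γ_{v + s w_k}(t)` are the variation
fields with initial derivatives `w_k = e_k(0)`. The density of the Riemannian measure pulled
back by `exp_p` is, on the other hand, the square root of the **Gram determinant**
`det (g(L f₀(o), L f₀(o')))_{o,o'}` of the differential `L = d(exp_p)_{tv}` on a
`g_p`-orthonormal basis `f₀ = (v, w_k)` of `T_pM`. This file identifies the two (Chavel 2006,
§III.4, formula for `√g(t; ξ) = det 𝒜(t; ξ) / t^{n-1}` in the proof of Thm. III.4.3):

* `mfderiv_expMap_smul_apply_eq_inv_smul_velocity`: `L(w_k) = t⁻¹ J_k(t)` (`t ≠ 0`) for a `C¹`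
  complete connection (from the computation of `velocity_geodesicVariation_eq_mfderiv_expMap`,
  `J_k(t) = L(t w_k)`, run for `C¹` connections);
* `mfderiv_expMap_smul_apply_smul_self`: the radial direction, `L(t v) = t γ̇_v(t)` (Gauss-lemma
  bookkeeping: `γ_{v + s v}(t) = γ_v((1 + s) t)`);
* `det_eq_det_some_of_apply_some_none`, `det_gram_option_mul_pow_eq_det_sq`: the linear
  algebra — a matrix on `Option ι` with `G none none = 1` and `G (some k) none = 0` has
  `det G = det G|_{ι×ι}`, and the Gram matrix of the vectors `x none = u`, `x (some k) = t⁻¹ J_k`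
  with `g(u,u) = 1`, `g(J_k, u) = 0`, `J_k = ∑_i g(J_k, e_i) e_i` has determinant
  `det(A)² / t^{2 card ι}`;
* `det_gram_mfderiv_expMap_frame`: **the identity**
  `det (g(L f₀ o, L f₀ o')) · t^{2 card ι} = det A(t)²` along `γ_v`, for a full `g`-orthonormal
  frame `f t : Option ι → T_{γ_v t}M` with `f t none = γ̇_v(t)` and `card (Option ι) = dim M`,
  the variation fields `J_k` of `w_k = f 0 (some k)` being normal to `γ̇_v` (which is the case
  as `g_p(w_k, v) = 0`, `normalJacobiTensor_frame`).

No definitions, no named facts.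

## References

* I. Chavel, *Riemannian Geometry: A Modern Introduction*, 2nd ed. (2006), §III.4, Thm. III.4.3
  and its proof. [Chavel2006]
* J. M. Lee, *Introduction to Riemannian Manifolds*, 2nd ed. (2018), Prop. 10.10, Lemma 5.18.
  [LeeRiemannianManifolds2018]
-/

noncomputable section

open Bundle Set Function Filter
open scoped Manifold ContDiff Topology Matrix

namespace Literature.Geometry.Riemannian

open Literature.Geometry.Lorentzian

/-! ### Linear algebra: block determinant on `Option ι` and the Gram matrix of `(u, t⁻¹ J_k)` -/

section LinearAlgebra

/-- **Block-triangular determinant on `Option ι`**: if `G none none = 1` and the column `none`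
vanishes below the corner (`G (some k) none = 0`), then `det G` is the determinant of the
`ι × ι` block `(G (some k) (some l))` (reindex `Option ι ≃ ι ⊕ Unit` and
`Matrix.det_fromBlocks_zero₁₂`). [folklore] -/
theorem det_eq_det_some_of_apply_some_none {ι : Type*} [Fintype ι] [DecidableEq ι]
    {R : Type*} [CommRing R] (G : Matrix (Option ι) (Option ι) R) (hnn : G none none = 1)
    (hsn : ∀ k, G (some k) none = 0) :
    G.det = (Matrix.of fun k l : ι ↦ G (some k) (some l)).det := by
  have h1 : G.submatrix (Equiv.optionEquivSumPUnit ι : Option ι ≃ ι ⊕ Unit).symm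
      (Equiv.optionEquivSumPUnit ι : Option ι ≃ ι ⊕ Unit).symm =
      Matrix.fromBlocks (Matrix.of fun k l : ι ↦ G (some k) (some l)) 0
        (Matrix.of fun (_ : Unit) (l : ι) ↦ G none (some l))
        (Matrix.of fun _ _ : Unit ↦ G none none) := by
    ext (k | k) (l | l)
    · rfl
    · exact hsn k
    · rfl
    · rfl
  rw [← Matrix.det_submatrix_equiv_self
    (Equiv.optionEquivSumPUnit ι : Option ι ≃ ι ⊕ Unit).symm G, h1,
    Matrix.det_fromBlocks_zero₁₂, Matrix.det_unique (Matrix.of fun _ _ : Unit ↦ G none none),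
    Matrix.of_apply, hnn, mul_one]

/-- **Gram determinant of a frame adapted to a unit vector.** Let `B` be a bilinear form, `u`
a vector with `B(u, u) = 1`, `J_k` vectors with `B(J_k, u) = 0` which expand as
`J_k = ∑_i B(J_k, e_i) e_i` in a family `e_i`, and `t ≠ 0`. Then the Gram matrix of the family
`x none = u`, `x (some k) = t⁻¹ J_k` satisfies `det (B(x o, x o')) · t^{2 card ι} = det(A)²`
with `A_{ik} = B(J_k, e_i)`: indeed `B(x (some k), x (some l)) = t⁻² (AᵀA)_{kl}` and the
`none` column is `(1, 0, …, 0)`. (The computation behind `√g(t;ξ) = det 𝒜 / t^{n-1}`,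
Chavel 2006, §III.4.) [folklore] -/
theorem det_gram_option_mul_pow_eq_det_sq {V : Type*} [TopologicalSpace V] [AddCommGroup V]
    [Module ℝ V] {ι : Type*} [Fintype ι] [DecidableEq ι] (B : V →L[ℝ] V →L[ℝ] ℝ)
    (x : Option ι → V) (u : V) (J e : ι → V) {t : ℝ} (ht : t ≠ 0) (hnone : x none = u)
    (hsome : ∀ k, x (some k) = t⁻¹ • J k) (huu : B u u = 1) (hJu : ∀ k, B (J k) u = 0)
    (hexp : ∀ k, J k = ∑ i, B (J k) (e i) • e i) :
    (Matrix.of fun o o' ↦ B (x o) (x o')).det * t ^ (2 * Fintype.card ι) =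
      (Matrix.of fun i k ↦ B (J k) (e i)).det ^ 2 := by
  set A : Matrix ι ι ℝ := Matrix.of fun i k ↦ B (J k) (e i) with hA
  set G : Matrix (Option ι) (Option ι) ℝ := Matrix.of fun o o' ↦ B (x o) (x o') with hG
  -- `B(J_k, J_l) = (AᵀA)_{kl}`
  have hJJ : ∀ k l, B (J k) (J l) = ∑ i, A i k * A i l := by
    intro k l
    have h := congrArg (fun z ↦ B (J k) z) (hexp l)
    simp only [map_sum, map_smul, smul_eq_mul] at h
    rw [h]
    refine Finset.sum_congr rfl fun i _ ↦ ?_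
    simp only [hA, Matrix.of_apply]
    ring
  -- the entries of `G`
  have hnn : G none none = 1 := by
    simp only [hG, Matrix.of_apply, hnone, huu]
  have hsn : ∀ k, G (some k) none = 0 := by
    intro k
    simp only [hG, Matrix.of_apply, hnone, hsome, map_smul, smul_apply, hJu,
      smul_eq_mul, mul_zero]
  have hss : ∀ k l, G (some k) (some l) = t⁻¹ * t⁻¹ * (Aᵀ * A) k l := by
    intro k l
    simp only [hG, Matrix.of_apply, hsome, map_smul, smul_apply, smul_eq_mul,
      hJJ, Matrix.mul_apply, Matrix.transpose_apply]
    ring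
  have hsub :
      (Matrix.of fun k l : ι ↦ G (some k) (some l)) = (t⁻¹ * t⁻¹) • (Aᵀ * A) := by
    ext k l
    simp only [Matrix.of_apply, Matrix.smul_apply, smul_eq_mul, hss]
  have htt : (t⁻¹ * t⁻¹) ^ Fintype.card ι * t ^ (2 * Fintype.card ι) = 1 := by
    have h2 : t⁻¹ * t⁻¹ * t ^ 2 = 1 := by field_simp
    rw [pow_mul, ← mul_pow, h2, one_pow]
  rw [det_eq_det_some_of_apply_some_none G hnn hsn, hsub, Matrix.det_smul, Matrix.det_mul,
    Matrix.det_transpose]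
  linear_combination A.det ^ 2 * htt

end LinearAlgebra

/-! ### Velocity of an affine reparametrisation at `0` -/

section Velocity

variable {E : Type*} [NormedAddCommGroup E] [NormedSpace ℝ E] {H : Type*} [TopologicalSpace H]
  {I : ModelWithCorners ℝ E H} {M : Type*} [TopologicalSpace M] [ChartedSpace H M]

/-- Velocity at `0` of an affine reparametrisation, cross-fibre form in the model space:
`(s ↦ γ(a s + b))'(0) = a γ'(b)` (`velocity_comp_affine` at `s = 0`). [folklore] -/
theorem velocity_comp_affine_zero (γ : ℝ → M) (a b : ℝ) :
    (show E from velocity I (fun s ↦ γ (a * s + b)) 0) =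
      a • (show E from velocity I γ b) := by
  have h := velocity_comp_affine (I := I) γ a b 0
  have key : ∀ s : ℝ, s = b →
      (show E from a • velocity I γ s) = a • (show E from velocity I γ b) := by
    intro s hs
    subst hs
    rfl
  exact h.trans (key _ (by ring))

end Velocity

/-! ### The differential of `exp_p` along `γ_v`: variation fields and the radial direction -/

section Connection

variable {E : Type*} [NormedAddCommGroup E] [NormedSpace ℝ E] [FiniteDimensional ℝ E]
  {H : Type*} [TopologicalSpace H] {I : ModelWithCorners ℝ E H}
  {M : Type*} [TopologicalSpace M] [ChartedSpace H M] [IsManifold I ∞ M]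
  [CompleteSpace E] [T2Space M] [I.Boundaryless]
  {cov : CovariantDerivative I E (TangentSpace I : M → Type _)}
  [CovariantDerivative.ContMDiffCovariantDerivative cov 1]

/-- The variation field is the differential of the exponential map, for a `C¹` complete
connection (the computation of `velocity_geodesicVariation_eq_mfderiv_expMap`, which is stated for
`C^∞` connections, run with `contMDiff_expMap_of_isGeodesicallyComplete` at `k = 1`):
`∂_s|₀ γ_{v+sw}(t) = d(exp_x)|_{tv}(tw)`. Private: the public statements are the `t⁻¹`-form
`mfderiv_expMap_smul_apply_eq_inv_smul_velocity` and the radial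
`mfderiv_expMap_smul_apply_smul_self`. [cite: LeeRiemannianManifolds2018, Prop. 10.10] -/
private theorem velocity_geodesicVariation_eq_mfderiv_expMap_C1
    (hc : IsGeodesicallyComplete cov) (x : M) (v w : TangentSpace I x) (t : ℝ) :
    velocity I (fun s : ℝ ↦ maximalGeodesic cov x (v + s • w) t) 0 =
      mfderiv 𝓘(ℝ, E) I (fun u : E ↦ expMap cov x (show TangentSpace I x from u))
        (t • (show E from v)) (t • (show E from w)) := by
  have h : (fun s : ℝ ↦ maximalGeodesic cov x (v + s • w) t) = fun s : ℝ ↦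
      (fun u : E ↦ expMap cov x (show TangentSpace I x from u))
        (t • (show E from v) + s • (t • (show E from w))) := by
    funext s
    have h1 : t • (show E from v) + s • (t • (show E from w)) = t • (v + s • w) := by
      simp only [smul_add, smul_comm s t]
      rfl
    rw [h1]
    exact (expMap_smul hc x (v + s • w) t).symm
  rw [h]
  exact velocity_comp_lineAt_zero
    ((contMDiff_expMap_of_isGeodesicallyComplete (k := 1) le_rfl hc x).mdifferentiableAt
      (by simp)) _

/-- **The differential of `exp_x` along `γ_v` through variation fields** (Lee 2018,
Prop. 10.10: "`J(t) = d(exp_p)_{tv}(t w)`", divided by `t ≠ 0`), for a geodesically complete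
`C¹` connection: `d(exp_x)|_{tv}(w) = t⁻¹ ∂_s|₀ γ_{v+sw}(t)`.
[cite: LeeRiemannianManifolds2018, Prop. 10.10] -/
theorem mfderiv_expMap_smul_apply_eq_inv_smul_velocity (hc : IsGeodesicallyComplete cov) (x : M)
    (v w : TangentSpace I x) {t : ℝ} (ht : t ≠ 0) :
    (show E from mfderiv 𝓘(ℝ, E) I (fun u : E ↦ expMap cov x (show TangentSpace I x from u))
        (t • (show E from v)) (show E from w)) =
      t⁻¹ • (show E from velocity I (fun s : ℝ ↦ maximalGeodesic cov x (v + s • w) t) 0) :=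
  (eq_inv_smul_iff₀ ht).2 ((map_smul _ t _).symm.trans
    (velocity_geodesicVariation_eq_mfderiv_expMap_C1 hc x v w t).symm)

/-- **The radial direction of `d(exp_x)`** (Gauss-lemma bookkeeping; Lee 2018, proof of
Thm. 6.9 / Prop. 5.19 (b)): `d(exp_x)|_{tv}(tv) = t γ_v'(t)` on a geodesically complete `C¹`
connection — `d(exp_x)|_{tv}(tv) = ∂_s|₀ γ_{v+sv}(t)` and `γ_{(1+s)v}(t) = γ_v((1+s)t)`
(`maximalGeodesic_smul`).
[cite: LeeRiemannianManifolds2018, Lemma 5.18 and Thm. 6.9 (proof)] -/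
theorem mfderiv_expMap_smul_apply_smul_self (hc : IsGeodesicallyComplete cov) (x : M)
    (v : TangentSpace I x) (t : ℝ) :
    (show E from mfderiv 𝓘(ℝ, E) I (fun u : E ↦ expMap cov x (show TangentSpace I x from u))
        (t • (show E from v)) (t • (show E from v))) =
      t • (show E from velocity I (maximalGeodesic cov x v) t) := by
  rw [← velocity_geodesicVariation_eq_mfderiv_expMap_C1 hc x v v t]
  have h : (fun s : ℝ ↦ maximalGeodesic cov x (v + s • v) t) =
      fun s : ℝ ↦ maximalGeodesic cov x v (t * s + t) := by
    funext s
    have h1 : v + s • v = (1 + s) • v := by rw [add_smul, one_smul]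
    rw [h1, maximalGeodesic_smul hc x v (1 + s) t]
    congr 1
    ring
  rw [h]
  exact velocity_comp_affine_zero (I := I) (maximalGeodesic cov x v) t t

end Connection

/-! ### The Gram determinant of `d(exp_p)_{tv}` on a frame -/

section Frame

variable {E : Type*} [NormedAddCommGroup E] [NormedSpace ℝ E] [FiniteDimensional ℝ E]
  {H : Type*} [TopologicalSpace H] {I : ModelWithCorners ℝ E H}
  {M : Type*} [TopologicalSpace M] [ChartedSpace H M] [IsManifold I ∞ M] {n : ℕ∞ω}
  [CompleteSpace E] [T2Space M] [I.Boundaryless]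

/-- **The Gram determinant of `d(exp_p)_{tv}` on a frame is `det A(t)² / t^{2(dim-1)}`** (Chavel
2006, §III.4, proof of Thm. III.4.3: `√g(t;ξ) = t^{1-n} det 𝒜(t;ξ)`). Along `γ_v` (complete
Levi-Civita connection), let `f t : Option ι → T_{γ_v t}M` be a full frame with
`f t none = γ̇_v(t)`, `g`-orthonormal on `(a, b)`, `card (Option ι) = dim M`; put
`w_k = f 0 (some k) ∈ T_pM`, `J_k(t) = ∂_s|₀ γ_{v + s w_k}(t)` (assumed normal to `γ̇_v(t)`),
`A_{ik}(t) = g(J_k(t), f t (some i))` and `L = d(exp_p)_{tv}` (`T_pM` read as the model space `E`).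
Then for `t ∈ (a, b)`, `t ≠ 0`:
`det (g(L(f 0 o), L(f 0 o')))_{o,o'} · t^{2 card ι} = det A(t)²` — because
`L(f 0 none) = L v = γ̇_v(t)` (`mfderiv_expMap_smul_apply_smul_self`), `L(w_k) = t⁻¹ J_k(t)`
(`mfderiv_expMap_smul_apply_eq_inv_smul_velocity`), `g(γ̇, γ̇) = 1`,
`g(J_k, γ̇) = 0` and `g(J_k, J_l) = (AᵀA)_{kl}` (`eq_sum_normal_of_val_eq_zero`), so that the
Gram matrix is `diag(1, t⁻² AᵀA)` up to a vanishing block (`det_gram_option_mul_pow_eq_det_sq`).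
[cite: Chavel2006, §III.4, Thm. III.4.3 (proof)] -/
theorem det_gram_mfderiv_expMap_frame
    (g : PseudoRiemannianMetric I n E (TangentSpace I : M → Type _)) [g.HasLeviCivita]
    [CovariantDerivative.ContMDiffCovariantDerivative g.leviCivita 1]
    (hc : IsGeodesicallyComplete g.leviCivita) (p : M) (v : TangentSpace I p)
    {ι : Type*} [Fintype ι] [DecidableEq ι] {a b : ℝ}
    (f : Π t : ℝ, Option ι → TangentSpace I (maximalGeodesic g.leviCivita p v t))
    (hfnone : ∀ t, f t none = velocity I (maximalGeodesic g.leviCivita p v) t)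
    (hon : ∀ t ∈ Ioo a b, ∀ o o',
      g.val (maximalGeodesic g.leviCivita p v t) (f t o) (f t o') = if o = o' then 1 else 0)
    (hcard : Fintype.card (Option ι) = Module.finrank ℝ E)
    (hnormal : ∀ (k : ι) (t : ℝ), g.val (maximalGeodesic g.leviCivita p v t)
      (velocity I (fun s' : ℝ ↦ maximalGeodesic g.leviCivita p
        (v + s' • (show TangentSpace I p from (show E from f 0 (some k)))) t) 0)
      (velocity I (maximalGeodesic g.leviCivita p v) t) = 0)
    {t : ℝ} (ht : t ∈ Ioo a b) (ht0 : t ≠ 0) :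
    (Matrix.of fun o o' : Option ι ↦ g.val (maximalGeodesic g.leviCivita p v t)
      (mfderiv 𝓘(ℝ, E) I (fun u : E ↦ expMap g.leviCivita p (show TangentSpace I p from u))
          (t • (show E from v)) (show E from f 0 o))
      (mfderiv 𝓘(ℝ, E) I (fun u : E ↦ expMap g.leviCivita p (show TangentSpace I p from u))
          (t • (show E from v)) (show E from f 0 o'))).det * t ^ (2 * Fintype.card ι) =
    (Matrix.of fun i k : ι ↦ g.val (maximalGeodesic g.leviCivita p v t)
      (velocity I (fun s' : ℝ ↦ maximalGeodesic g.leviCivita p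
        (v + s' • (show TangentSpace I p from (show E from f 0 (some k)))) t) 0)
      (f t (some i))).det ^ 2 := by
  set L := mfderiv 𝓘(ℝ, E) I
    (fun u : E ↦ expMap g.leviCivita p (show TangentSpace I p from u)) (t • (show E from v))
  -- the variation fields `J_k(t)` and the velocity `u = γ̇_v(t)`
  set J : ι → TangentSpace I (maximalGeodesic g.leviCivita p v t) := fun k ↦
    velocity I (fun s' : ℝ ↦ maximalGeodesic g.leviCivita p
      (v + s' • (show TangentSpace I p from (show E from f 0 (some k)))) t) 0
  have hγv : velocity I (maximalGeodesic g.leviCivita p v) 0 = v :=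
    (maximalGeodesic_of_isGeodesicallyComplete hc p v).2.2.2
  have hf0 : f 0 none = v := (hfnone 0).trans hγv
  -- `L (f 0 none) = L v = γ̇_v(t)`
  have hnone : L (show E from f 0 none) =
      (show E from velocity I (maximalGeodesic g.leviCivita p v) t) := by
    have h1 : (show E from L (t • (show E from v))) =
        t • (show E from velocity I (maximalGeodesic g.leviCivita p v) t) :=
      mfderiv_expMap_smul_apply_smul_self hc p v t
    have h2 : t • L (show E from v) =
        t • (show E from velocity I (maximalGeodesic g.leviCivita p v) t) :=
      (map_smul L t (show E from v)).symm.trans h1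
    have h3 : t • L (show E from f 0 none) = t • L (show E from v) :=
      congrArg (fun z : E ↦ t • L z) hf0
    exact smul_right_injective E ht0 (h3.trans h2)
  -- `L (w_k) = t⁻¹ J_k(t)`
  have hsome : ∀ k, L (show E from f 0 (some k)) = t⁻¹ • (show E from J k) := fun k ↦
    mfderiv_expMap_smul_apply_eq_inv_smul_velocity hc p v
      (show TangentSpace I p from (show E from f 0 (some k))) ht0
  -- metric entries at `γ_v t`
  have huu : g.val (maximalGeodesic g.leviCivita p v t)
      (velocity I (maximalGeodesic g.leviCivita p v) t)
      (velocity I (maximalGeodesic g.leviCivita p v) t) = 1 := by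
    have h := hon t ht none none
    rw [if_pos rfl, hfnone t] at h
    exact h
  have hJu : ∀ k, g.val (maximalGeodesic g.leviCivita p v t) (J k)
      (velocity I (maximalGeodesic g.leviCivita p v) t) = 0 := fun k ↦ hnormal k t
  have hexp : ∀ k, J k =
      ∑ i, g.val (maximalGeodesic g.leviCivita p v t) (J k) (f t (some i)) • f t (some i) := by
    intro k
    refine eq_sum_normal_of_val_eq_zero g (maximalGeodesic g.leviCivita p v t) (hon t ht)
      hcard ?_
    rw [hfnone t]
    exact hJu k
  exact det_gram_option_mul_pow_eq_det_sq (g.val (maximalGeodesic g.leviCivita p v t))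
    (fun o ↦ (show E from L (show E from f 0 o))) _ J (fun i ↦ f t (some i)) ht0 hnone hsome
    huu hJu hexp

end Frame

end Literature.Geometry.Riemannian

end
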